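import Literature.MathematicalPhysics.QuantumFieldTheory.Balaban1983to89.B1Eq324BenfattoSect5TupleClustersAnchored
import Literature.MathematicalPhysics.QuantumFieldTheory.Balaban1983to89.B1Eq324BenfattoSect5RegionCount
import Literature.MathematicalPhysics.QuantumFieldTheory.Balaban1983to89.B1Eq324BenfattoSect5SlotMasses
import Literature.MathematicalPhysics.QuantumFieldTheory.Balaban1983to89.B1Eq324BenfattoSect5FreeCumulants
import HarnessLib

/-!
# `Balaban1983to89.B1Eq324BenfattoSect5HlCumulants` — [BenfattoEtAl1978] (5.11) p. 155 INSIDE THE FREE CUMULANTS: dropping the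
# far-reaching part `H^{(l)}` of `H_J = Ĥ_J + H^{(l)}` changes every free truncated expectation by an EXTENSIVE, EXPONENTIALLY SMALL amount —
# `|𝓔̂₀^T(H_J; k) − 𝓔̂₀^T(Ĥ_J; k)| ≤ 2^k·C_k·(|J|·A·e^{−(c/2)w}·S₁)·(A·S₂)^{k−1}` — PROVED

statement-level skeleton of published theorems with citation tags; proofs where landed; nothing here is a claim about the
Yang–Mills mass gap

WHY THIS MODULE (cell `pub-ymgap`, seat `dag-n08-c`, node N08; item (R3) of the assembly's remaining-work map).  Print removes `H^{(l)}`
from the INTEGRAND by (5.11) (`…Sect5Eq511.abs_Hl_le`, a factor `e^{±ε|I|}`), but the Lemma's main term is `Σ_k 𝓔̂₀^T(H_J;k)/k!` with the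
FULL `H_J`, while the iteration produces free cumulants of `Ĥ_J`'s pieces.  The difference is a sum over the colourings of `{Ĥ_J, H^{(l)}}`
using `H^{(l)}` at least once (`…Sect5FreeCumulants.cumulantOf_add_sub_eq_of_moments`); each is a joint free cumulant with one slot made of
the REMAINDER tuples (`…Sect5Eq511.Hl_eq_sum_remainder`: every such tuple has `d(Δ) ≥ w`, `le_connLength_of_mem_remainder`) and is bounded by
`…Sect5TupleClustersAnchored.abs_ursellOf_tupleSums_condField_le_anchored_of_uniform` — the remainder slot's mass
(`≤ |J|·A·e^{(δ/2)D²d}e^{−(c/2)w}·S₁` by `…Sect5SlotMasses.classSum_le_card_mul`, `c = ϰ/2 − (δ/2)D²√d`) times, for every other slot, its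
mass weighted by the decay from the remainder tuple's anchor (`≤ A·e^{(δ/2)D²d}·K(δ/2k,d)·S₂` uniformly, by
`…Sect5RegionCount.decayWeighted_classSum_le_card_mul` at `R_A = {anchor}`).  Print p. 155: *"we find, using definition 4.5: |H^{(l)}_J| ≤
s₁Ab^D e^{−(ϰ/4)b^{3/2}}|I|"*; p. 159: *"Collecting all the errors made in this process (4.7) is proven"*.

WHAT IS PROVED (theorems only; no definition, no named fact, no `sorry`; axioms standard).
* `hatH_eq_tupleSum` — `Ĥ_J = Σ_pΣ_{Δ∈hatTuples}Σ_n term` (one tuple class).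
* ★★ **`abs_truncatedExp_hamiltonian_sub_hatH_le`** — for `d ≥ 1`, coefficients supported in `J` and bounded by `A ≥ 0`, `L ≥ 1`,
  `B ⊇` the tesserae meeting `J`, a rate `0 < δ ≤ log((2d+α²)/(2d))` with `δD²√d < ϰ`, every `w` and every order `k+1`:
  `|𝓔̂₀^T(H_J; k+1) − 𝓔̂₀^T(Ĥ_J; k+1)| ≤ 2^{k+1}·2^{(k+1)D}2^{2^{(k+1)D}}K₀^{(k+1)D}·M_l·M̂^k`, `K₀ = max(1, C₀₀)`,
  `M_l = A·e^{(δ/2)D²d}·e^{−(c/2)w}·|J|·Σ_p|admissible p D|·K(c/2p,d)^{p−1}`, `M̂ = A·e^{(δ/2)D²d}·K(δ/(2(k+1)),d)·Σ_p|admissible p D|·K(c/p,d)^{p−1}`,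
  `c = ϰ/2 − (δ/2)D²√d` — linear in `|J|`, exponentially small in the corridor width `w`.
* ★ `abs_cumulantSum_hamiltonian_sub_hatH_le` — the same summed over `1 ≤ k ≤ t` with `1/k!`: the square bracket of (4.6)–(4.7) with `Ĥ_J`
  in place of `H_J` costs `Σ_{k=1}^{t} 2^k·C_k·M_l·M̂_k^{k−1}/k!`.

HONEST SCOPE / NOT HERE.  The choice of `δ`, `w ≍ M·b^{3/2}` and the insertion into `errTerm` are the assembly's; `BasicLemmaPrinted` stays OPEN.  NOT summit progress; count-neutral for N08; nothing of [Balaban1985UV3] is asserted.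
-/

noncomputable section

open Finset MeasureTheory
open scoped BigOperators

namespace Literature.MathematicalPhysics.QuantumFieldTheory.Balaban1983to89.B1Eq324BenfattoSect5HlCumulants

open _root_.MeasureTheory _root_.ProbabilityTheory
open Literature.Probability.LatticeModels (ursellOf cumulantOf)
open Literature.MathematicalPhysics.QuantumFieldTheory
open Literature.MathematicalPhysics.QuantumFieldTheory.Balaban1983to89.B1Eq324BenfattoLemma
open Literature.MathematicalPhysics.QuantumFieldTheory.Balaban1983to89.B1Eq324BenfattoConnLength (connLength_nonneg)
open Literature.MathematicalPhysics.QuantumFieldTheory.Balaban1983to89.B1Eq324BenfattoSect5Boxes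
open Literature.MathematicalPhysics.QuantumFieldTheory.Balaban1983to89.B1Eq324BenfattoSect5Eq511
open Literature.MathematicalPhysics.QuantumFieldTheory.Balaban1983to89.B1Eq324BenfattoSect5SlotMoments (tupleSum_condField_moments)
open Literature.MathematicalPhysics.QuantumFieldTheory.Balaban1983to89.B1Eq324BenfattoSect5SlotMasses (classSum_le_card_mul)
open Literature.MathematicalPhysics.QuantumFieldTheory.Balaban1983to89.B1Eq324BenfattoSect5RegionCount (decayWeighted_classSum_le_card_mul)
open Literature.MathematicalPhysics.QuantumFieldTheory.Balaban1983to89.B1Eq324BenfattoSect5TupleClustersAnchored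
  (abs_ursellOf_tupleSums_condField_le_anchored_of_uniform)
open Literature.MathematicalPhysics.QuantumFieldTheory.Balaban1983to89.B1Eq324BenfattoSect5FreeCumulants (cumulantOf_add_sub_eq_of_moments)

variable {d : ℕ} {α β : ℝ} {s D : ℕ} {ϰ : ℝ} {a : Coef d} {J : Finset (B1Eq324BenfattoLemma.Site d)} {L : ℕ}
variable {B : Finset (B1Eq324BenfattoLemma.Site d)}

/-- **`Ĥ_J` AS ONE TUPLE CLASS**: `Ĥ_J(z) = Σ_pΣ_{Δ∈hatTuples J p}Σ_n term` (complement of the remainder class of `H^{(l)}`).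
[cite: BenfattoEtAl1978, (5.9) p.155] -/
theorem hatH_eq_tupleSum (hJ : CoefSupportedIn a J) (hL : 0 < L) (w : ℕ) (z : B1Eq324BenfattoLemma.Site d → ℝ) :
    hatH s D ϰ a L w B z = ∑ p ∈ Finset.Icc 1 s, ∑ Δ ∈ hatTuples J p L w B, ∑ n ∈ admissible p D, term ϰ a z p Δ n := by
  classical
  have h := hamiltonian_eq_hatH_add_Hl s D ϰ a J L w B z
  rw [Hl_eq_sum_remainder hJ hL, hamiltonian_eq_sum_tuplesIn hJ J] at h
  simp_rw [tuplesIn_self] at h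
  have h' : hatH s D ϰ a L w B z = (∑ p ∈ Finset.Icc 1 s, ∑ Δ : Fin p → J, ∑ n ∈ admissible p D, term ϰ a z p Δ n) -
      ∑ p ∈ Finset.Icc 1 s, ∑ Δ ∈ Finset.univ \ hatTuples J p L w B, ∑ n ∈ admissible p D, term ϰ a z p Δ n := by
    linarith
  rw [h', ← Finset.sum_sub_distrib]
  refine Finset.sum_congr rfl fun p _ => ?_
  rw [sub_eq_iff_eq_add, ← Finset.sum_sdiff (Finset.subset_univ (hatTuples J p L w B)), add_comm]

/-- **(5.11) INSIDE THE FREE CUMULANTS**: for `d ≥ 1`, coefficients supported in `J` with `|A| ≤ A`, `L ≥ 1`, `B ⊇` the tesserae meeting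
`J`, a rate `0 < δ ≤ log((2d+α²)/(2d))` with `δD²√d < ϰ` (so `c = ϰ/2 − (δ/2)D²√d > 0`), every corridor width `w` and every order:
`|𝓔̂₀^T(H_J; k+1) − 𝓔̂₀^T(Ĥ_J; k+1)| ≤ 2^{k+1}·2^{(k+1)D}2^{2^{(k+1)D}}K₀^{(k+1)D}·M_l·M̂^k` with `K₀ = max(1,C₀₀)`,
`M_l = A e^{(δ/2)D²d}e^{−(c/2)w}·|J|·Σ_p|admissible p D|·K(c/2p,d)^{p−1}` (the remainder slot: `d(Δ) ≥ w` on it) and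
`M̂ = A e^{(δ/2)D²d}·(1·K(δ/(2(k+1)),d))·Σ_p|admissible p D|·K(c/p,d)^{p−1}` (any slot, decay-weighted from a one-tessera anchor) — the
`2^{k+1}` counts the colourings of `{Ĥ_J, H^{(l)}}`; extensive (one factor `|J|`) and exponentially small in `w`.
[cite: BenfattoEtAl1978, (5.11) p.155, (2.7) p.147, Appendix D p.166] -/
theorem abs_truncatedExp_hamiltonian_sub_hatH_le (hα : 0 < α) (hβ : 0 < β) (hd : 0 < d) (hJ : CoefSupportedIn a J) {A : ℝ}
    (hA0 : 0 ≤ A) (hA : ∀ (p : ℕ) (Δ : Fin p → B1Eq324BenfattoLemma.Site d) (n : Fin p → ℕ), |a p Δ n| ≤ A)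
    (hL : 0 < L) (hB : J.image (boxIndex L) ⊆ B) {δ : ℝ} (hδ : 0 < δ) (hδle : δ ≤ Real.log ((2 * d + α ^ 2) / (2 * d)))
    (hδϰ : δ * ((D : ℝ) ^ 2 * Real.sqrt d) < ϰ) (w k : ℕ) :
    |truncatedExp (P0 d α β) (hamiltonian s D ϰ a J) (k + 1) - truncatedExp (P0 d α β) (hatH s D ϰ a L w B) (k + 1)| ≤
      2 ^ (k + 1) * (2 ^ ((k + 1) * D) * 2 ^ 2 ^ ((k + 1) * D) * (max 1 (freeCov d α β 0 0)) ^ ((k + 1) * D)) *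
        ((A * Real.exp (δ / 2 * ((D : ℝ) ^ 2 * d)) *
            Real.exp (-((ϰ / 2 - δ / 2 * ((D : ℝ) ^ 2 * Real.sqrt d)) / 2 * w))) * J.card *
          ∑ p ∈ Finset.Icc 1 s, ((admissible p D).card : ℝ) *
            ((2 / (1 - Real.exp (-((ϰ / 2 - δ / 2 * ((D : ℝ) ^ 2 * Real.sqrt d)) / 2 / (p : ℕ) / Real.sqrt d))) *
              Real.exp ((ϰ / 2 - δ / 2 * ((D : ℝ) ^ 2 * Real.sqrt d)) / 2 / (p : ℕ) / Real.sqrt d)) ^ d) ^ (p - 1)) *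
        (A * Real.exp (δ / 2 * ((D : ℝ) ^ 2 * d)) *
          ((1 : ℝ) * (2 / (1 - Real.exp (-(δ / (2 * ((k + 1 : ℕ) : ℝ)) / Real.sqrt d))) *
            Real.exp (δ / (2 * ((k + 1 : ℕ) : ℝ)) / Real.sqrt d)) ^ d) *
          ∑ p ∈ Finset.Icc 1 s, ((admissible p D).card : ℝ) *
            ((2 / (1 - Real.exp (-((ϰ / 2 - δ / 2 * ((D : ℝ) ^ 2 * Real.sqrt d)) / (p : ℕ) / Real.sqrt d))) *
              Real.exp ((ϰ / 2 - δ / 2 * ((D : ℝ) ^ 2 * Real.sqrt d)) / (p : ℕ) / Real.sqrt d)) ^ d) ^ (p - 1)) ^ k := by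
  classical
  -- constants
  set c : ℝ := ϰ / 2 - δ / 2 * ((D : ℝ) ^ 2 * Real.sqrt d) with hc
  have hc0 : 0 < c := by rw [hc]; linarith
  set K₀ : ℝ := max 1 (freeCov d α β 0 0) with hK₀
  have hK₀1 : 1 ≤ K₀ := le_max_left _ _
  have hK₀' : freeCov d α β 0 0 ≤ K₀ := le_max_right _ _
  set C : ℝ := 2 ^ ((k + 1) * D) * 2 ^ 2 ^ ((k + 1) * D) * K₀ ^ ((k + 1) * D) with hC
  have hC0 : 0 ≤ C := by positivity
  set S₁ : ℝ := ∑ p ∈ Finset.Icc 1 s, ((admissible p D).card : ℝ) *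
    ((2 / (1 - Real.exp (-(c / 2 / (p : ℕ) / Real.sqrt d))) * Real.exp (c / 2 / (p : ℕ) / Real.sqrt d)) ^ d) ^ (p - 1) with hS₁
  set S₂ : ℝ := ∑ p ∈ Finset.Icc 1 s, ((admissible p D).card : ℝ) *
    ((2 / (1 - Real.exp (-(c / (p : ℕ) / Real.sqrt d))) * Real.exp (c / (p : ℕ) / Real.sqrt d)) ^ d) ^ (p - 1) with hS₂
  set Ml : ℝ := (A * Real.exp (δ / 2 * ((D : ℝ) ^ 2 * d)) * Real.exp (-(c / 2 * w))) * J.card * S₁ with hMl_def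
  set Mh : ℝ := A * Real.exp (δ / 2 * ((D : ℝ) ^ 2 * d)) *
    ((1 : ℝ) * (2 / (1 - Real.exp (-(δ / (2 * ((k + 1 : ℕ) : ℝ)) / Real.sqrt d))) *
      Real.exp (δ / (2 * ((k + 1 : ℕ) : ℝ)) / Real.sqrt d)) ^ d) * S₂ with hMh_def
  show _ ≤ 2 ^ (k + 1) * C * Ml * Mh ^ k
  -- the free field as the conditional field on `∅`
  set μ := condField d α β ∅ (fun _ : B1Eq324BenfattoLemma.Site d => (0 : ℝ)) with hμ
  have hP0 : P0 d α β = μ := (condField_empty d α β _).symm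
  haveI : IsProbabilityMeasure μ :=
    Literature.MathematicalPhysics.QuantumFieldTheory.Balaban1983to89.B1Eq324BenfattoMarkov.isProbabilityMeasure_condField hα hβ _ _
  -- the two tuple classes: `Ĥ_J` (colour 0) and `H^{(l)}` (colour 1)
  set cls : Fin 2 → (p : ℕ) → Finset (Fin p → J) :=
    fun cc p => if cc = 0 then hatTuples J p L w B else Finset.univ \ hatTuples J p L w B with hcls
  set Y : Fin 2 → (B1Eq324BenfattoLemma.Site d → ℝ) → ℝ :=
    fun cc z => ∑ p ∈ Finset.Icc 1 s, ∑ Δ ∈ cls cc p, ∑ n ∈ admissible p D, term ϰ a z p Δ n with hY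
  have hY0 : ∀ z, hatH s D ϰ a L w B z = Y 0 z := fun z => by
    rw [hY, hatH_eq_tupleSum hJ hL w z]
    simp only [hcls, if_true]
  have hY1 : ∀ z, Hl s D ϰ a J L w B z = Y 1 z := fun z => by
    rw [hY, Hl_eq_sum_remainder hJ hL]
    simp only [hcls, one_ne_zero, if_false]
  have hH : ∀ z, hamiltonian s D ϰ a J z = Y 0 z + Y 1 z := fun z => by
    rw [hamiltonian_eq_hatH_add_Hl s D ϰ a J L w B z, hY0, hY1]
  -- moments under the free field
  have hmom : ∀ cc, AEStronglyMeasurable (Y cc) μ ∧ ∀ q : ℕ, Integrable (fun z => |Y cc z| ^ q) μ := by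
    intro cc
    have h := tupleSum_condField_moments (s := s) (D := D) (ϰ := ϰ) (a := a) hα hβ ∅
      (fun _ : B1Eq324BenfattoLemma.Site d => (0 : ℝ)) (cls cc) (K := 0) le_rfl
      (fun y _ => by rw [condMean_empty, abs_zero]) 0
    exact ⟨h.1, h.2.1⟩
  -- the colouring expansion of the difference
  have hexp := cumulantOf_add_sub_eq_of_moments (μ := μ) (Y := fun cc z => Y cc z) (fun cc => (hmom cc).1) k
    (fun cc p _ => (hmom cc).2 p)
  have hlhs : truncatedExp (P0 d α β) (hamiltonian s D ϰ a J) (k + 1) - truncatedExp (P0 d α β) (hatH s D ϰ a L w B) (k + 1) =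
      cumulantOf (fun r => ∫ z, (Y 0 z + Y 1 z) ^ r ∂μ) (k + 1) - cumulantOf (fun r => ∫ z, (Y 0 z) ^ r ∂μ) (k + 1) := by
    simp only [truncatedExp, hP0]
    congr 2
    · funext r; exact integral_congr_ae (ae_of_all _ fun z => by beta_reduce; rw [hH z])
    · funext r; exact integral_congr_ae (ae_of_all _ fun z => by beta_reduce; rw [hY0 z])
  rw [hlhs, hexp]
  -- per colouring using colour 1: the anchored cluster bound
  have hu : ∀ (j : Fin (k + 1)), ∀ p ∈ Finset.Icc 1 s, ∀ (f : Fin (k + 1) → Fin 2), ∀ Δ ∈ cls (f j) p, ∀ i,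
      |condMean (freeCov d α β) ∅ (fun _ : B1Eq324BenfattoLemma.Site d => (0 : ℝ)) (Δ i : B1Eq324BenfattoLemma.Site d)| ≤ K₀ := by
    intro j p _ f Δ _ i
    rw [condMean_empty, abs_zero]; exact zero_le_one.trans hK₀1
  have hexpθ : ∀ {p : ℕ} (Δ : Fin p → J),
      Real.exp (-(ϰ / 2) * connLength fun i => (Δ i : B1Eq324BenfattoLemma.Site d)) *
        Real.exp (δ / 2 * ((D : ℝ) ^ 2 * (Real.sqrt d * connLength (fun i => (Δ i : B1Eq324BenfattoLemma.Site d)) + d))) =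
        Real.exp (δ / 2 * ((D : ℝ) ^ 2 * d)) * Real.exp (-(c * connLength fun i => (Δ i : B1Eq324BenfattoLemma.Site d))) := by
    intro p Δ
    rw [← Real.exp_add, ← Real.exp_add]
    congr 1
    rw [hc]; ring
  -- the uniform decay-weighted mass of any class, anchored at one tessera
  have hMh : ∀ (cc : Fin 2) (y : B1Eq324BenfattoLemma.Site d),
      ∑ p ∈ Finset.Icc 1 s, ∑ Δ ∈ cls cc p, ∑ n ∈ admissible p D,
        |a p (fun i => (Δ i : B1Eq324BenfattoLemma.Site d)) n| *
          Real.exp (-(ϰ / 2) * connLength fun i => (Δ i : B1Eq324BenfattoLemma.Site d)) *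
          (Real.exp (δ / 2 * ((D : ℝ) ^ 2 * (Real.sqrt d * connLength (fun i => (Δ i : B1Eq324BenfattoLemma.Site d)) + d))) *
            Real.exp (-(δ / (2 * Fintype.card (Fin (k + 1))) * ∑ jj, |((y jj : ℝ) -
              ((if h : 0 < p then (Δ ⟨0, h⟩ : B1Eq324BenfattoLemma.Site d) else (0 : B1Eq324BenfattoLemma.Site d)) jj : ℝ))|))) ≤ Mh := by
    intro cc y
    rw [Fintype.card_fin]
    have hc₂ : 0 < δ / (2 * ((k + 1 : ℕ) : ℝ)) := by positivity
    have hw : ∀ (p : ℕ) (hp : p ∈ Finset.Icc 1 s), ∀ Δ ∈ cls cc p, ∀ n ∈ admissible p D,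
        |a p (fun i => (Δ i : B1Eq324BenfattoLemma.Site d)) n| *
          Real.exp (-(ϰ / 2) * connLength fun i => (Δ i : B1Eq324BenfattoLemma.Site d)) *
          (Real.exp (δ / 2 * ((D : ℝ) ^ 2 * (Real.sqrt d * connLength (fun i => (Δ i : B1Eq324BenfattoLemma.Site d)) + d))) *
            Real.exp (-(δ / (2 * ((k + 1 : ℕ) : ℝ)) * ∑ jj, |((y jj : ℝ) -
              ((if h : 0 < p then (Δ ⟨0, h⟩ : B1Eq324BenfattoLemma.Site d) else (0 : B1Eq324BenfattoLemma.Site d)) jj : ℝ))|))) ≤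
          A * Real.exp (δ / 2 * ((D : ℝ) ^ 2 * d)) * Real.exp (-(c * connLength fun i => (Δ i : B1Eq324BenfattoLemma.Site d))) *
            Real.exp (-(δ / (2 * ((k + 1 : ℕ) : ℝ)) * ∑ jj, |((y jj : ℝ) -
              ((Δ ⟨0, (Finset.mem_Icc.1 hp).1⟩ : B1Eq324BenfattoLemma.Site d) jj : ℝ))|)) := by
      intro p hp Δ _ n _
      rw [dif_pos (show 0 < p from (Finset.mem_Icc.1 hp).1)]
      have hre : |a p (fun i => (Δ i : B1Eq324BenfattoLemma.Site d)) n| *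
          Real.exp (-(ϰ / 2) * connLength fun i => (Δ i : B1Eq324BenfattoLemma.Site d)) *
          (Real.exp (δ / 2 * ((D : ℝ) ^ 2 * (Real.sqrt d * connLength (fun i => (Δ i : B1Eq324BenfattoLemma.Site d)) + d))) *
            Real.exp (-(δ / (2 * ((k + 1 : ℕ) : ℝ)) * ∑ jj, |((y jj : ℝ) -
              ((Δ ⟨0, (Finset.mem_Icc.1 hp).1⟩ : B1Eq324BenfattoLemma.Site d) jj : ℝ))|))) =
          |a p (fun i => (Δ i : B1Eq324BenfattoLemma.Site d)) n| *
            ((Real.exp (-(ϰ / 2) * connLength fun i => (Δ i : B1Eq324BenfattoLemma.Site d)) *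
              Real.exp (δ / 2 * ((D : ℝ) ^ 2 * (Real.sqrt d * connLength (fun i => (Δ i : B1Eq324BenfattoLemma.Site d)) + d)))) *
            Real.exp (-(δ / (2 * ((k + 1 : ℕ) : ℝ)) * ∑ jj, |((y jj : ℝ) -
              ((Δ ⟨0, (Finset.mem_Icc.1 hp).1⟩ : B1Eq324BenfattoLemma.Site d) jj : ℝ))|))) := by ring
      rw [hre, hexpθ Δ]
      have hpos : 0 ≤ Real.exp (δ / 2 * ((D : ℝ) ^ 2 * d)) * Real.exp (-(c * connLength fun i => (Δ i : B1Eq324BenfattoLemma.Site d))) *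
          Real.exp (-(δ / (2 * ((k + 1 : ℕ) : ℝ)) * ∑ jj, |((y jj : ℝ) -
            ((Δ ⟨0, (Finset.mem_Icc.1 hp).1⟩ : B1Eq324BenfattoLemma.Site d) jj : ℝ))|)) := by positivity
      calc |a p (fun i => (Δ i : B1Eq324BenfattoLemma.Site d)) n| *
            (Real.exp (δ / 2 * ((D : ℝ) ^ 2 * d)) * Real.exp (-(c * connLength fun i => (Δ i : B1Eq324BenfattoLemma.Site d))) *
              Real.exp (-(δ / (2 * ((k + 1 : ℕ) : ℝ)) * ∑ jj, |((y jj : ℝ) -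
                ((Δ ⟨0, (Finset.mem_Icc.1 hp).1⟩ : B1Eq324BenfattoLemma.Site d) jj : ℝ))|)))
          ≤ A * (Real.exp (δ / 2 * ((D : ℝ) ^ 2 * d)) * Real.exp (-(c * connLength fun i => (Δ i : B1Eq324BenfattoLemma.Site d))) *
              Real.exp (-(δ / (2 * ((k + 1 : ℕ) : ℝ)) * ∑ jj, |((y jj : ℝ) -
                ((Δ ⟨0, (Finset.mem_Icc.1 hp).1⟩ : B1Eq324BenfattoLemma.Site d) jj : ℝ))|))) :=
            mul_le_mul_of_nonneg_right (hA p _ n) hpos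
        _ = _ := by ring
    have h := decayWeighted_classSum_le_card_mul (s := s) (D := D) (Jr := J) hc0 hc₂ (mul_nonneg hA0 (Real.exp_pos _).le)
      (cls cc) ({y} : Finset (B1Eq324BenfattoLemma.Site d)) (fun z => ∑ jj, |((y jj : ℝ) - (z jj : ℝ))|)
      (fun z _ => ⟨y, Finset.mem_singleton_self y, le_rfl⟩) _ hw
    rw [Finset.card_singleton, Nat.cast_one] at h
    exact h
  -- the mass of the remainder class
  have hMl : ∑ p ∈ Finset.Icc 1 s, ∑ Δ ∈ cls 1 p, ∑ n ∈ admissible p D,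
      |a p (fun i => (Δ i : B1Eq324BenfattoLemma.Site d)) n| *
        Real.exp (-(ϰ / 2) * connLength fun i => (Δ i : B1Eq324BenfattoLemma.Site d)) *
        Real.exp (δ / 2 * ((D : ℝ) ^ 2 * (Real.sqrt d * connLength (fun i => (Δ i : B1Eq324BenfattoLemma.Site d)) + d))) ≤ Ml := by
    have hc' : 0 < c / 2 := by positivity
    have hw : ∀ p ∈ Finset.Icc 1 s, ∀ Δ ∈ cls 1 p, ∀ n ∈ admissible p D,
        |a p (fun i => (Δ i : B1Eq324BenfattoLemma.Site d)) n| *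
          Real.exp (-(ϰ / 2) * connLength fun i => (Δ i : B1Eq324BenfattoLemma.Site d)) *
          Real.exp (δ / 2 * ((D : ℝ) ^ 2 * (Real.sqrt d * connLength (fun i => (Δ i : B1Eq324BenfattoLemma.Site d)) + d))) ≤
          A * Real.exp (δ / 2 * ((D : ℝ) ^ 2 * d)) * Real.exp (-(c / 2 * w)) *
            Real.exp (-(c / 2 * connLength fun i => (Δ i : B1Eq324BenfattoLemma.Site d))) := by
      intro p hp Δ hΔ n _
      have hΔ' : Δ ∈ Finset.univ \ hatTuples J p L w B := by
        simpa only [hcls, one_ne_zero, if_false] using hΔ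
      have hdw := le_connLength_of_mem_remainder (w := w) hL hB hΔ'
      rw [mul_assoc, hexpθ Δ]
      have hsplit : Real.exp (-(c * connLength fun i => (Δ i : B1Eq324BenfattoLemma.Site d))) ≤
          Real.exp (-(c / 2 * w)) * Real.exp (-(c / 2 * connLength fun i => (Δ i : B1Eq324BenfattoLemma.Site d))) := by
        rw [← Real.exp_add, Real.exp_le_exp]
        nlinarith
      calc |a p (fun i => (Δ i : B1Eq324BenfattoLemma.Site d)) n| *
            (Real.exp (δ / 2 * ((D : ℝ) ^ 2 * d)) * Real.exp (-(c * connLength fun i => (Δ i : B1Eq324BenfattoLemma.Site d))))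
          ≤ A * (Real.exp (δ / 2 * ((D : ℝ) ^ 2 * d)) * (Real.exp (-(c / 2 * w)) *
              Real.exp (-(c / 2 * connLength fun i => (Δ i : B1Eq324BenfattoLemma.Site d))))) :=
            mul_le_mul (hA p _ n) (mul_le_mul_of_nonneg_left hsplit (Real.exp_pos _).le) (by positivity) hA0
        _ = A * Real.exp (δ / 2 * ((D : ℝ) ^ 2 * d)) * Real.exp (-(c / 2 * w)) *
              Real.exp (-(c / 2 * connLength fun i => (Δ i : B1Eq324BenfattoLemma.Site d))) := by ring
    exact classSum_le_card_mul (s := s) (D := D) (Jr := J) hc'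
      (mul_nonneg (mul_nonneg hA0 (Real.exp_pos _).le) (Real.exp_pos _).le) (cls 1) J (fun p _ Δ _ i => (Δ i).2) _ hw
  have hMh0 : 0 ≤ Mh := by
    have := hMh 0 0
    exact le_trans (Finset.sum_nonneg fun p _ => Finset.sum_nonneg fun Δ _ => Finset.sum_nonneg fun n _ =>
      mul_nonneg (mul_nonneg (abs_nonneg _) (Real.exp_pos _).le) (mul_nonneg (Real.exp_pos _).le (Real.exp_pos _).le)) this
  have hMl0 : 0 ≤ Ml :=
    le_trans (Finset.sum_nonneg fun p _ => Finset.sum_nonneg fun Δ _ => Finset.sum_nonneg fun n _ =>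
      mul_nonneg (mul_nonneg (abs_nonneg _) (Real.exp_pos _).le) (Real.exp_pos _).le) hMl
  -- each colouring that uses colour 1
  have hcol : ∀ f : Fin (k + 1) → Fin 2, (∃ j, f j = 1) →
      |ursellOf (fun P : Finset (Fin (k + 1)) => ∫ z, ∏ j ∈ P, Y (f j) z ∂μ) Finset.univ| ≤ C * Ml * Mh ^ k := by
    intro f hf
    obtain ⟨j₁, hj₁⟩ := hf
    have h := abs_ursellOf_tupleSums_condField_le_anchored_of_uniform (s := s) (D := D) (ϰ := ϰ) (a := a)
      (σ := Fin (k + 1)) hα hβ hd ∅ (fun _ : B1Eq324BenfattoLemma.Site d => (0 : ℝ)) (fun j => cls (f j)) hK₀1 hK₀'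
      (fun j p hp Δ hΔ i => hu j p hp f Δ hΔ i) hδ.le hδle j₁ (fun _ => Mh) (fun j _ y => hMh (f j) y)
    rw [Fintype.card_fin, Finset.prod_const, Finset.card_erase_of_mem (Finset.mem_univ j₁), Finset.card_univ,
      Fintype.card_fin, Nat.add_sub_cancel] at h
    refine h.trans ?_
    rw [hj₁]
    exact mul_le_mul_of_nonneg_right (mul_le_mul_of_nonneg_left hMl hC0) (pow_nonneg hMh0 _)
  -- sum over the colourings
  calc |∑ f ∈ Finset.univ.filter (fun f : Fin (k + 1) → Fin 2 => ∃ j, f j = 1),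
        ursellOf (fun P : Finset (Fin (k + 1)) => ∫ z, ∏ j ∈ P, Y (f j) z ∂μ) Finset.univ|
      ≤ ∑ f ∈ Finset.univ.filter (fun f : Fin (k + 1) → Fin 2 => ∃ j, f j = 1),
          |ursellOf (fun P : Finset (Fin (k + 1)) => ∫ z, ∏ j ∈ P, Y (f j) z ∂μ) Finset.univ| := Finset.abs_sum_le_sum_abs _ _
    _ ≤ ∑ f ∈ Finset.univ.filter (fun f : Fin (k + 1) → Fin 2 => ∃ j, f j = 1), C * Ml * Mh ^ k :=
        Finset.sum_le_sum fun f hf => hcol f (Finset.mem_filter.1 hf).2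
    _ ≤ ∑ _f : Fin (k + 1) → Fin 2, C * Ml * Mh ^ k :=
        Finset.sum_le_sum_of_subset_of_nonneg (Finset.filter_subset _ _) fun f _ _ =>
          mul_nonneg (mul_nonneg hC0 hMl0) (pow_nonneg hMh0 _)
    _ = 2 ^ (k + 1) * C * Ml * Mh ^ k := by
        rw [Finset.sum_const, Finset.card_univ, Fintype.card_fun, Fintype.card_fin, Fintype.card_fin, nsmul_eq_mul]
        push_cast
        ring

/-- **THE SQUARE BRACKET OF (4.6)–(4.7) WITH `Ĥ_J` IN PLACE OF `H_J`**: summing `abs_truncatedExp_hamiltonian_sub_hatH_le` over the orders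
`1 ≤ k ≤ t` with the `1/k!` of `cumulantSum`:
`|Σ_{k≤t}𝓔̂₀^T(H_J;k)/k! − Σ_{k≤t}𝓔̂₀^T(Ĥ_J;k)/k!| ≤ Σ_{k=1}^{t} 2^k·2^{kD}2^{2^{kD}}K₀^{kD}·M_l·M̂_k^{k−1}/k!` (`M̂_k` at rate `δ/(2k)`) — still one
factor `|J|` and one factor `e^{−(c/2)w}`. [cite: BenfattoEtAl1978, (5.11) p.155 and (4.6)–(4.7) p.152] -/
theorem abs_cumulantSum_hamiltonian_sub_hatH_le (hα : 0 < α) (hβ : 0 < β) (hd : 0 < d) (hJ : CoefSupportedIn a J) {A : ℝ}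
    (hA0 : 0 ≤ A) (hA : ∀ (p : ℕ) (Δ : Fin p → B1Eq324BenfattoLemma.Site d) (n : Fin p → ℕ), |a p Δ n| ≤ A)
    (hL : 0 < L) (hB : J.image (boxIndex L) ⊆ B) {δ : ℝ} (hδ : 0 < δ) (hδle : δ ≤ Real.log ((2 * d + α ^ 2) / (2 * d)))
    (hδϰ : δ * ((D : ℝ) ^ 2 * Real.sqrt d) < ϰ) (w t : ℕ) :
    |cumulantSum (P0 d α β) (hamiltonian s D ϰ a J) t - cumulantSum (P0 d α β) (hatH s D ϰ a L w B) t| ≤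
      ∑ k ∈ Finset.Icc 1 t, (2 ^ k * (2 ^ (k * D) * 2 ^ 2 ^ (k * D) * (max 1 (freeCov d α β 0 0)) ^ (k * D)) *
        ((A * Real.exp (δ / 2 * ((D : ℝ) ^ 2 * d)) *
            Real.exp (-((ϰ / 2 - δ / 2 * ((D : ℝ) ^ 2 * Real.sqrt d)) / 2 * w))) * J.card *
          ∑ p ∈ Finset.Icc 1 s, ((admissible p D).card : ℝ) *
            ((2 / (1 - Real.exp (-((ϰ / 2 - δ / 2 * ((D : ℝ) ^ 2 * Real.sqrt d)) / 2 / (p : ℕ) / Real.sqrt d))) *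
              Real.exp ((ϰ / 2 - δ / 2 * ((D : ℝ) ^ 2 * Real.sqrt d)) / 2 / (p : ℕ) / Real.sqrt d)) ^ d) ^ (p - 1)) *
        (A * Real.exp (δ / 2 * ((D : ℝ) ^ 2 * d)) *
          ((1 : ℝ) * (2 / (1 - Real.exp (-(δ / (2 * ((k : ℕ) : ℝ)) / Real.sqrt d))) *
            Real.exp (δ / (2 * ((k : ℕ) : ℝ)) / Real.sqrt d)) ^ d) *
          ∑ p ∈ Finset.Icc 1 s, ((admissible p D).card : ℝ) *
            ((2 / (1 - Real.exp (-((ϰ / 2 - δ / 2 * ((D : ℝ) ^ 2 * Real.sqrt d)) / (p : ℕ) / Real.sqrt d))) *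
              Real.exp ((ϰ / 2 - δ / 2 * ((D : ℝ) ^ 2 * Real.sqrt d)) / (p : ℕ) / Real.sqrt d)) ^ d) ^ (p - 1)) ^ (k - 1)) /
        (k.factorial : ℝ) := by
  rw [cumulantSum, cumulantSum, ← Finset.sum_sub_distrib]
  refine (Finset.abs_sum_le_sum_abs _ _).trans (Finset.sum_le_sum fun k hk => ?_)
  have hk1 : 1 ≤ k := (Finset.mem_Icc.1 hk).1
  obtain ⟨k', rfl⟩ := Nat.exists_eq_succ_of_ne_zero (Nat.one_le_iff_ne_zero.1 hk1)
  simp only [Nat.succ_eq_add_one, Nat.add_sub_cancel]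
  rw [← sub_div, abs_div, abs_of_pos (by positivity : (0 : ℝ) < ((k' + 1).factorial : ℝ))]
  refine div_le_div_of_nonneg_right ?_ (by positivity)
  have h := abs_truncatedExp_hamiltonian_sub_hatH_le (s := s) (D := D) (ϰ := ϰ) (B := B) hα hβ hd hJ hA0 hA hL hB hδ hδle hδϰ w k'
  simpa only [Nat.cast_add, Nat.cast_one, Nat.cast_succ] using h

end Literature.MathematicalPhysics.QuantumFieldTheory.Balaban1983to89.B1Eq324BenfattoSect5HlCumulants

end
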